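import Summits.QuantumFields.GaugeBoot.StrongCouplingOrderSuN
import Summits.QuantumFields.GaugeBoot.Targets
import HarnessLib

/-!
# The plaquette: the level-`M` SU(N) bootstrap bounds on `u_P` and on the torus-averaged plaquette are within `O(|β|^{(M-4)/4+1})` of the Wilson value (gauge-boot, L1 supplement)

HONEST FRAMING (cell `pub-gaugeboot`, page 1 of every file): the venture produces certified bounds
on lattice expectations at stated coupling, gauge group, dimension and torus size; NOT a mass gap,
NOT a continuum limit, NOT a string tension; NOT Yang–Mills-summit-bearing (barriers
`FixedCouplingUltralocality`, `PerturbativeInvisibility`). Structural, qualitatively quantitative: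
constants are not computed; no number is certified.

## Content

The cell's certified object is the torus-averaged plaquette `meanPlaquette` (`Targets.lean`,
SCOPING A2) and the single plaquette `u_P = plaquetteTrace`. Both are word observables of degree
`4` (`plaquetteTraceCM_mem_wordTruncation`, `meanPlaquetteCM_mem_wordTruncation`), so the
strong-coupling-order theorems of `StrongCouplingOrderSuN.lean` apply verbatim:

* ★★★ `plaquette_levelValues_subset_Icc_pow_suN` / `meanPlaquette_levelValues_subset_Icc_pow_suN` —
  `SU(N)` on `(ℤ/L)^d`, every `d`, `L`, `N`, level `M ≥ 4`: there is `C ≥ 0` with, for every real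
  `β`, `levelValuesSuN N β M u ⊆ [⟨u⟩_β - C|β|^{(M-4)/4+1}, ⟨u⟩_β + C|β|^{(M-4)/4+1}]` — the level-`M`
  SDP bounds on the (mean) plaquette reproduce the strong-coupling behaviour of the Wilson
  expectation to order `(M-4)/4+1` (level 8: `O(β²)`, level 12: `O(β³)`, …);
* ★★ `plaquette_levelValues_zero_suN` — at `β = 0` the level-`M ≥ 4` bootstrap pins the plaquette
  EXACTLY (to its Haar value).

References: P. Anderson, M. Kruczenski, Nucl. Phys. B 921 (2017) Fig. 3; V. Kazakov, Z. Zheng,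
arXiv:2203.11360 §4; Yu. Makeenko (2002) Problem 12.7. Folklore mechanism; truncated statement new.
-/

noncomputable section

open MeasureTheory Filter Topology NormedSpace
open Literature.MathematicalPhysics.QuantumFieldTheory (LatticeRep haarProbability Edge Site GaugeConfig
  Plaquette plaquetteHolonomy wilsonAction wilsonMeasure isProbabilityMeasure_wilsonMeasure)
open Literature.MathematicalPhysics.QuantumLattice

namespace Summit.QuantumFields.GaugeBoot

/-! ## The plaquette observables are word observables of degree `4` -/

section Torus

variable {d L : ℕ} {G : Type*} [Group G] [TopologicalSpace G] (r : LatticeRep G)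

/-- **`u_P` is a word function of degree `4`.** -/
theorem plaquetteTrace_mem_wordFunctions (x : Site d L) (i j : Fin d) :
    plaquetteTrace (d := d) (L := L) r.ρ x i j ∈ wordFunctions r (Set.univ : Set (Edge d L)) 4 := by
  have hE : EntriesIn r (Set.univ : Set (Edge d L)) 4
      (fun U : GaugeConfig d L G => r.ρ (plaquetteHolonomy U x i j)) := by
    have := (((entriesIn_rho r (Set.mem_univ (x, i)) le_rfl).mul r
      (entriesIn_rho r (Set.mem_univ (x.shift i, j)) le_rfl)).mul r
      (entriesIn_rho_inv r (Set.mem_univ (x.shift j, i)) le_rfl)).mul r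
      (entriesIn_rho_inv r (Set.mem_univ (x, j)) le_rfl)
    simpa only [plaquetteHolonomy, map_mul] using this
  have h : plaquetteTrace (d := d) (L := L) r.ρ x i j =
      (r.N : ℝ)⁻¹ • fun U : GaugeConfig d L G => (r.ρ (plaquetteHolonomy U x i j)).trace.re := by
    funext U
    simp [plaquetteTrace]
  rw [h]
  exact Submodule.smul_mem _ _ hE.trace_re

/-- `u_P` as a continuous observable. -/
def plaquetteTraceCM (x : Site d L) (i j : Fin d) : C(GaugeConfig d L G, ℝ) :=
  ⟨plaquetteTrace r.ρ x i j, by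
    obtain ⟨g, -, hg⟩ := (mem_wordFunctions_iff r).1 (plaquetteTrace_mem_wordFunctions r x i j)
    rw [← hg]; exact g.continuous⟩

/-- `plaquetteTraceCM` is `u_P`. -/
@[simp] theorem coe_plaquetteTraceCM (x : Site d L) (i j : Fin d) :
    ⇑(plaquetteTraceCM (d := d) (L := L) r x i j) = plaquetteTrace r.ρ x i j := rfl

/-- ★ **`u_P` is a level-`4` test function.** -/
theorem plaquetteTraceCM_mem_wordTruncation (x : Site d L) (i j : Fin d) :
    plaquetteTraceCM r x i j ∈ wordTruncation (ι := Edge d L) r 4 :=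
  mem_wordTruncation_of_mem_wordSpace r
    ((coe_mem_wordFunctions_iff r).1 (plaquetteTrace_mem_wordFunctions r x i j))

variable [NeZero L]

/-- The torus-averaged plaquette as a continuous observable. -/
def meanPlaquetteCM : C(GaugeConfig d L G, ℝ) :=
  (Fintype.card (Plaquette d L) : ℝ)⁻¹ • ∑ p : Plaquette d L, plaquetteTraceCM r p.1 p.2.1.1 p.2.1.2

/-- `meanPlaquetteCM` is `meanPlaquette`. -/
@[simp] theorem coe_meanPlaquetteCM :
    ⇑(meanPlaquetteCM (d := d) (L := L) r) = meanPlaquette r.ρ := by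
  funext U
  simp [meanPlaquetteCM, meanPlaquette, ContinuousMap.coe_sum, Finset.sum_apply]

/-- ★ **The mean plaquette is a level-`4` test function.** -/
theorem meanPlaquetteCM_mem_wordTruncation :
    meanPlaquetteCM (d := d) (L := L) r ∈ wordTruncation (ι := Edge d L) r 4 := by
  unfold meanPlaquetteCM
  exact Submodule.smul_mem _ _ (Submodule.sum_mem _ fun p _ =>
    plaquetteTraceCM_mem_wordTruncation r p.1 p.2.1.1 p.2.1.2)

end Torus

/-! ## `SU(N)`: the plaquette bounds to strong-coupling order -/

section SUN

variable {d L : ℕ} [NeZero L] (N : ℕ)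

/-- ★★★ **The level-`M` `SU(N)` bootstrap bounds on the plaquette `u_P` lie within
`C|β|^{(M-4)/4+1}` of its Wilson expectation**, for every real `β` (`M ≥ 4`; `C` depends on `M`,
not on `β`). [folklore mechanism; truncated statement new] -/
theorem plaquette_levelValues_subset_Icc_pow_suN (x : Site d L) (i j : Fin d) {M : ℕ} (hM : 4 ≤ M) :
    ∃ C : ℝ, 0 ≤ C ∧ ∀ β : ℝ,
      levelValuesSuN (d := d) (L := L) N β M (plaquetteTraceCM (fundamentalLatticeRep N) x i j) ⊆
        Set.Icc (∫ U, plaquetteTrace (fundamentalRep (Fin N)) x i j U ∂(wilsonMeasure (fundamentalRep (Fin N)) β)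
            - C * |β| ^ ((M - 4) / 4 + 1))
          (∫ U, plaquetteTrace (fundamentalRep (Fin N)) x i j U ∂(wilsonMeasure (fundamentalRep (Fin N)) β)
            + C * |β| ^ ((M - 4) / 4 + 1)) := by
  obtain ⟨C, hC0, hC⟩ := levelValues_subset_Icc_pow_suN (d := d) (L := L) N
    (plaquetteTraceCM_mem_wordTruncation (fundamentalLatticeRep N) x i j) ((M - 4) / 4 + 1)
  refine ⟨C, hC0, fun β => ?_⟩
  have h := hC M (by have := Nat.div_mul_le_self (M - 4) 4; omega)
    (by have := Nat.div_mul_le_self (M - 4) 4; omega) β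
  rw [coe_plaquetteTraceCM] at h
  exact h

/-- ★★★ **The same for the torus-averaged plaquette** — the cell's certified object. -/
theorem meanPlaquette_levelValues_subset_Icc_pow_suN {M : ℕ} (hM : 4 ≤ M) :
    ∃ C : ℝ, 0 ≤ C ∧ ∀ β : ℝ,
      levelValuesSuN (d := d) (L := L) N β M (meanPlaquetteCM (fundamentalLatticeRep N)) ⊆
        Set.Icc (∫ U, meanPlaquette (d := d) (L := L) (fundamentalRep (Fin N)) U
              ∂(wilsonMeasure (fundamentalRep (Fin N)) β) - C * |β| ^ ((M - 4) / 4 + 1))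
          (∫ U, meanPlaquette (d := d) (L := L) (fundamentalRep (Fin N)) U
              ∂(wilsonMeasure (fundamentalRep (Fin N)) β) + C * |β| ^ ((M - 4) / 4 + 1)) := by
  obtain ⟨C, hC0, hC⟩ := levelValues_subset_Icc_pow_suN (d := d) (L := L) N
    (meanPlaquetteCM_mem_wordTruncation (fundamentalLatticeRep N)) ((M - 4) / 4 + 1)
  refine ⟨C, hC0, fun β => ?_⟩
  have h := hC M (by have := Nat.div_mul_le_self (M - 4) 4; omega)
    (by have := Nat.div_mul_le_self (M - 4) 4; omega) β
  rw [coe_meanPlaquetteCM] at h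
  exact h

/-- ★★ **Width form**: any two level-`M` feasible values of the plaquette differ by at most
`C|β|^{(M-4)/4+1}`. -/
theorem plaquette_levelValues_width_le_pow_suN (x : Site d L) (i j : Fin d) {M : ℕ} (hM : 4 ≤ M) :
    ∃ C : ℝ, 0 ≤ C ∧ ∀ β : ℝ,
      ∀ s ∈ levelValuesSuN (d := d) (L := L) N β M (plaquetteTraceCM (fundamentalLatticeRep N) x i j),
      ∀ t ∈ levelValuesSuN (d := d) (L := L) N β M (plaquetteTraceCM (fundamentalLatticeRep N) x i j),
        |s - t| ≤ C * |β| ^ ((M - 4) / 4 + 1) :=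
  levelValues_width_le_pow_level_suN (d := d) (L := L) N
    (plaquetteTraceCM_mem_wordTruncation (fundamentalLatticeRep N) x i j) hM hM

/-- ★★ **At `β = 0` the level-`M ≥ 4` bootstrap pins the plaquette exactly** (to its Haar value).
[folklore] -/
theorem plaquette_levelValues_zero_suN (x : Site d L) (i j : Fin d) {M : ℕ} (hM : 4 ≤ M) :
    levelValuesSuN (d := d) (L := L) N 0 M (plaquetteTraceCM (fundamentalLatticeRep N) x i j) =
      {∫ U, plaquetteTrace (fundamentalRep (Fin N)) x i j U ∂(wilsonMeasure (fundamentalRep (Fin N)) 0)} := by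
  have h := levelValues_zero_eq_singleton_suN (d := d) (L := L) N hM
    (plaquetteTraceCM_mem_wordTruncation (fundamentalLatticeRep N) x i j)
  rw [coe_plaquetteTraceCM] at h
  exact h

end SUN

end Summit.QuantumFields.GaugeBoot

end
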